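import Summits.BirchSwinnertonDyer.BirchSwinnertonDyer.Theses.ShaPrimaryTransfer
import Literature.NumberTheory.EllipticCurves.KubertTateSevenMinimalModel
import Literature.NumberTheory.EllipticCurves.KubertTateM85ShaSeven
import Literature.NumberTheory.EllipticCurves.KubertTateM81ShaSeven
import Literature.NumberTheory.EllipticCurves.KubertTateM115ShaSeven
import Literature.NumberTheory.EllipticCurves.KubertTate171ShaSeven
import Literature.NumberTheory.EllipticCurves.ComplexMultiplicationLocalFactorsAux
import Literature.NumberTheory.EllipticCurves.OrdinaryPrimesProofs
import Literature.NumberTheory.EllipticCurves.PAdicLFunction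
import Literature.NumberTheory.EllipticCurves.SelmerCorankHolds
import Literature.NumberTheory.EllipticCurves.KubertTateSevenRational
import Literature.NumberTheory.EllipticCurves.IsogenyFrobeniusTraceProofs
import Literature.NumberTheory.EllipticCurves.IsogenyVariableChangeProofs
import Literature.NumberTheory.EllipticCurves.NoEverywhereGoodReductionRat
import Literature.NumberTheory.EllipticCurves.PAdicGrossZagierConstantTermProofs
import Literature.NumberTheory.EllipticCurves.QuadraticTwistSelmerPInfty
import Literature.NumberTheory.EllipticCurves.LFunctionSmulProofs
import Summits.BirchSwinnertonDyer.BirchSwinnertonDyer.Theorems.Rank1ResidualIntModelReduction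
import HarnessLib

/-!
# The door prime `7` is X2-admissible CLASS-WIDE on the tame Kubert–Tate family: `a₇(E_{m,n}) = 1`

Helper for item **stmt-BirchSwinnertonDyer-22356** (`FiniteShaComponentTransfer`, «T») of route
`ShaPrimaryTransfer`; closes nothing by itself; **BSD is NOT proved by this file**. It generalises
`…RowAtSeven` (the single curve `E_{−8/5}`) to the whole tame family: for COPRIME `m, n` with
`7 ∤ Δ(E_{m,n})`, the integral Kubert–Tate `7`-torsion curve
`E_{m,n} = kubertTateSeven m n = [n² + mn − m², m²n(n−m), m²n³(n−m), 0, 0]` is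

* a GLOBAL MINIMAL MODEL (tree `isGloballyMinimal_kubertTateSeven`, file `KubertTateSevenMinimalModel`), so
  the tree's `integralModelInt`, `Δ_min`, `a_p` are read off the integer equation (§2);
* of good reduction at `7` with **`#Ẽ_{m,n}(𝔽₇) = 7`, i.e. `a₇ = 1`** — `7` is good, ordinary and
  ANOMALOUS for every member (§1: the count depends only on `(m, n) mod 7`; the `24` nonsingular residue
  pairs are decided in the kernel; conceptually, the point `(0,0)` of order `7` survives reduction);
* hence **X2-admissible at its own door prime**: granting the route's X2 =
  `AnalyticRankLeSelmerCorank` (`p ≥ 5` good ordinary, globally minimal ⟹ `r_an ≤ s_p`),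
  `ord_{s=1} L(E_{m,n}, s) ≤ s₇(E_{m,n})` for EVERY tame coprime member, and `≤ rank E_{m,n}(ℚ)` wherever
  the door is open (`t₇ = 0`, e.g. by the `μ₇`-descent of `KubertTateSevenMuDescentBox`) — §3;
* instances (§4): `r_an(E_{−11/5}) ≤ 2 = rank`, `r_an(E_{−8}) ≤ 1 = rank`, `r_an(E_{17}) ≤ 1 = rank` under X2
  alone (`E_{−8/5}` is `…RowAtSeven`). No transfer `T` is invoked: unlike the doors at `2` and `3`, the
  door prime `7` is itself a Kato–Skinner–Urban prime.

## References

* [SilvermanAEC2009] J. H. Silverman, *AEC*, 2nd ed., VII.1 Rem. 1.1, VII.3 Prop. 3.1(b), VII.5 Prop. 5.1.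
* [GreenbergLNM1716] R. Greenberg, *Iwasawa theory for elliptic curves*, LNM 1716, §1 (pp. 54–57).
* [Fisher2001FiveSevenDescent] T. Fisher, JEMS 3 (2001), §§1–2.
-/

noncomputable section

set_option linter.dupNamespace false
set_option autoImplicit false

open WeierstrassCurve
open Literature.NumberTheory.EllipticCurves
open Summit.BirchSwinnertonDyer.BirchSwinnertonDyer.Theses.ShaPrimaryTransfer
open Summit.BirchSwinnertonDyer.BirchSwinnertonDyer.Rank1Residual

namespace Summit.BirchSwinnertonDyer.BirchSwinnertonDyer.Theorems.ShaPrimaryTransferRowAtSevenClassWide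

/-! ## §1 Reduction modulo `7`: `#Ẽ_{m,n}(𝔽₇) = 7` for every nonsingular residue pair -/

/-- The affine point count of `E_{a,b}` over `𝔽₇` is `6` for each of the `24` residue pairs `(a, b)` with
`Δ(E_{a,b}) ≠ 0` in `𝔽₇` (kernel decision over `𝔽₇ × 𝔽₇`). [folklore] -/
private theorem card_sol_zmod_seven : ∀ a b : ZMod 7, (kubertTateSeven a b).Δ ≠ 0 →
    Fintype.card {xy : ZMod 7 × ZMod 7 // xy.2 ^ 2 + (kubertTateSeven a b).a₁ * xy.1 * xy.2
      + (kubertTateSeven a b).a₃ * xy.2 = xy.1 ^ 3 + (kubertTateSeven a b).a₂ * xy.1 ^ 2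
      + (kubertTateSeven a b).a₄ * xy.1 + (kubertTateSeven a b).a₆} = 6 := by
  decide +kernel

/-- **`#E_{a,b}(𝔽₇) = 7` for every nonsingular Kubert–Tate `7`-torsion curve over `𝔽₇`** (the rational point
`(0,0)` of order `7` forces `7 ∣ #E(𝔽₇) ∈ [3, 13]`). [cite: SilvermanAEC2009, VII.3 Prop. 3.1(b)] -/
theorem natCard_point_kubertTateSeven_zmod_seven (a b : ZMod 7) (h : (kubertTateSeven a b).Δ ≠ 0) :
    Nat.card (kubertTateSeven a b).toAffine.Point = 7 := by
  have h1 := natCard_point_eq_one_add_card (F := ZMod 7) (kubertTateSeven a b) h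
  have h2 := card_sol_zmod_seven a b h
  simp only [h2] at h1
  exact h1

/-- The integer equation of `E_{m,n}` reduces modulo `7` to `E_{m̄,n̄}` over `𝔽₇`. [folklore] -/
theorem map_mk_zmod_seven (m n : ℤ) :
    (⟨n ^ 2 + m * n - m ^ 2, m ^ 2 * n * (n - m), m ^ 2 * n ^ 3 * (n - m), 0, 0⟩ : WeierstrassCurve ℤ).map
        (Int.castRingHom (ZMod 7)) = kubertTateSeven (m : ZMod 7) (n : ZMod 7) := by
  rw [mk_eq_kubertTateSeven_int, map_kubertTateSeven]
  simp

/-- `Δ(E_{m̄,n̄}) ≠ 0` in `𝔽₇` when `7 ∤ Δ(E_{m,n})`. [folklore] -/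
theorem Δ_zmod_seven_ne_zero (m n : ℤ) (h7 : ¬ (7 : ℤ) ∣ (kubertTateSeven m n).Δ) :
    (kubertTateSeven (m : ZMod 7) (n : ZMod 7)).Δ ≠ 0 := by
  rw [← map_mk_zmod_seven, map_Δ, mk_eq_kubertTateSeven_int, eq_intCast, Ne,
    ZMod.intCast_zmod_eq_zero_iff_dvd]
  exact_mod_cast h7

/-- **`#Ẽ_{m,n}(𝔽₇) = 7` for all integers `m, n` with `7 ∤ Δ(E_{m,n})`.** [cite: SilvermanAEC2009, VII.3 Prop. 3.1(b)] -/
theorem natCard_point_seven (m n : ℤ) (h7 : ¬ (7 : ℤ) ∣ (kubertTateSeven m n).Δ) :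
    Nat.card (((⟨n ^ 2 + m * n - m ^ 2, m ^ 2 * n * (n - m), m ^ 2 * n ^ 3 * (n - m), 0, 0⟩ :
      WeierstrassCurve ℤ).map (Int.castRingHom (ZMod 7))).toAffine.Point) = 7 := by
  rw [map_mk_zmod_seven]
  exact natCard_point_kubertTateSeven_zmod_seven _ _ (Δ_zmod_seven_ne_zero m n h7)

/-! ## §2 The integral model, `a₇ = 1`, good ordinary (anomalous) reduction at `7` — class-wide -/

/-- For a globally minimal `E_{m,n}/ℚ` the tree's integral model is the Kubert–Tate integer equation.
[cite: SilvermanAEC2009, VIII.8] -/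
theorem integralModelInt_kubertTateSeven (m n : ℤ) [(kubertTateSeven (m : ℚ) (n : ℚ)).IsGloballyMinimal] :
    integralModelInt (kubertTateSeven (m : ℚ) (n : ℚ)) =
      ⟨n ^ 2 + m * n - m ^ 2, m ^ 2 * n * (n - m), m ^ 2 * n ^ 3 * (n - m), 0, 0⟩ :=
  IntModel.integralModelInt_eq_of_map_eq _ (kubertTateSeven_rat_eq_map_mk m n).symm

/-- **`a₇(E_{m,n}) = 1` class-wide** (`m, n` coprime, `7 ∤ Δ`): `7` is ANOMALOUS for every tame member of the
Kubert–Tate `7`-torsion family. [cite: SilvermanAEC2009, VII.3 Prop. 3.1(b) and V.2] -/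
theorem frobeniusTrace_seven (m n : ℤ) (hcop : IsCoprime m n) (h7 : ¬ (7 : ℤ) ∣ (kubertTateSeven m n).Δ) :
    haveI := isGloballyMinimal_kubertTateSeven m n hcop h7
    (kubertTateSeven (m : ℚ) (n : ℚ)).frobeniusTrace 7 = 1 := by
  haveI := isGloballyMinimal_kubertTateSeven m n hcop h7
  rw [IntModel.frobeniusTrace_eq (integralModelInt_kubertTateSeven m n) (natCard_point_seven m n h7)]
  norm_num

/-- **`7` is a prime of good ORDINARY reduction of `E_{m,n}` class-wide** (`m, n` coprime, `7 ∤ Δ`):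
`7 ∤ Δ_min = Δ(E_{m,n})` and `7 ∤ a₇ = 1`. [cite: SilvermanAEC2009, VII.5 Prop. 5.1(a)] -/
theorem goodOrdinary_seven (m n : ℤ) (hcop : IsCoprime m n) (h7 : ¬ (7 : ℤ) ∣ (kubertTateSeven m n).Δ) :
    haveI := isGloballyMinimal_kubertTateSeven m n hcop h7
    (kubertTateSeven (m : ℚ) (n : ℚ)).HasGoodReductionAtPrime 7 ∧
      ¬ ((7 : ℕ) : ℤ) ∣ (kubertTateSeven (m : ℚ) (n : ℚ)).frobeniusTrace 7 := by
  haveI := isGloballyMinimal_kubertTateSeven m n hcop h7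
  refine ⟨hasGoodReductionAtPrime_of_not_dvd _ 7 ?_, ?_⟩
  · rw [IntModel.minimalDiscriminantInt_eq (integralModelInt_kubertTateSeven m n), mk_eq_kubertTateSeven_int]
    exact_mod_cast h7
  · rw [frobeniusTrace_seven m n hcop h7]
    decide

/-- `7` is good ordinary for `E_{m,n}` in the `IsOrdinaryAt` packaging of the `p`-adic `L`-function files.
[cite: SilvermanAEC2009, VII.5 Prop. 5.1(a)] -/
theorem isOrdinaryAt_seven (m n : ℤ) (hcop : IsCoprime m n) (h7 : ¬ (7 : ℤ) ∣ (kubertTateSeven m n).Δ) :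
    haveI := isGloballyMinimal_kubertTateSeven m n hcop h7
    IsOrdinaryAt (kubertTateSeven (m : ℚ) (n : ℚ)) 7 :=
  goodOrdinary_seven m n hcop h7

/-! ## §3 X2 at the door prime, class-wide -/

/-- **X2 applies at `p = 7` to EVERY tame coprime `E_{m,n}`**: granting `AnalyticRankLeSelmerCorank` (X2),
`ord_{s=1} L(E_{m,n}, s) ≤ s₇(E_{m,n}) = corank_{ℤ₇} Sel_{7^∞}(E_{m,n}/ℚ)`. CONDITIONAL on `hX2` only.
[cite: GreenbergLNM1716, §1 (pp. 54–57)] -/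
theorem analyticRank_le_selmerCorank_seven_of_X2 (hX2 : AnalyticRankLeSelmerCorank) (m n : ℤ)
    [(kubertTateSeven (m : ℚ) (n : ℚ)).IsElliptic] (hcop : IsCoprime m n)
    (h7 : ¬ (7 : ℤ) ∣ (kubertTateSeven m n).Δ) :
    (kubertTateSeven (m : ℚ) (n : ℚ)).analyticRank ≤ (kubertTateSeven (m : ℚ) (n : ℚ)).selmerCorank 7 := by
  haveI := isGloballyMinimal_kubertTateSeven m n hcop h7
  have hgo := goodOrdinary_seven m n hcop h7
  exact hX2 (kubertTateSeven (m : ℚ) (n : ℚ)) 7 (by norm_num) hgo.1 hgo.2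

/-- **X2 + an open door at `7` give the BSD inequality `ord_{s=1} L(E_{m,n}, s) ≤ rank E_{m,n}(ℚ)`** for every
tame coprime `E_{m,n}` with `t₇(E_{m,n}) = 0` (`s₇ = rank + t₇`). CONDITIONAL on `hX2` only.
[cite: GreenbergLNM1716, §1 (pp. 54–57)] [cite: SilvermanAEC2009, Thm. X.4.2(b)] -/
theorem analyticRank_le_mordellWeilRank_of_X2 (hX2 : AnalyticRankLeSelmerCorank) (m n : ℤ)
    [(kubertTateSeven (m : ℚ) (n : ℚ)).IsElliptic] (hcop : IsCoprime m n)
    (h7 : ¬ (7 : ℤ) ∣ (kubertTateSeven m n).Δ) (ht : (kubertTateSeven (m : ℚ) (n : ℚ)).shaCorank 7 = 0) :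
    (kubertTateSeven (m : ℚ) (n : ℚ)).analyticRank ≤ (kubertTateSeven (m : ℚ) (n : ℚ)).mordellWeilRank := by
  have h := analyticRank_le_selmerCorank_seven_of_X2 hX2 m n hcop h7
  rw [(kubertTateSeven (m : ℚ) (n : ℚ)).selmerCorank_eq_mordellWeilRank_add_holds 7, ht, add_zero] at h
  exact h

/-! ## §4 Instances: `E_{−11/5}` (rank `2`), `E_{−8}` (rank `1`), `E_{17}` (rank `1`) under X2 alone -/

/-- **`r_an(E_{−11/5}) ≤ 2 = rank E_{−11/5}(ℚ)` from X2 alone** (door prime `7` admissible; `t₇ = 0` by the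
`μ₇`-descent, tree `KubertTateM115Descent.shaCorank_seven_eq_zero`). [cite: GreenbergLNM1716, §1 (pp. 54–57)] -/
theorem analyticRank_M115_le_two_of_X2 (hX2 : AnalyticRankLeSelmerCorank) :
    haveI := KubertTateM115Descent.isElliptic
    (kubertTateSeven (((-11 : ℤ) : ℚ)) (((5 : ℤ) : ℚ))).analyticRank ≤ 2 := by
  haveI := KubertTateM115Descent.isElliptic
  have h := analyticRank_le_mordellWeilRank_of_X2 hX2 (-11) 5
    (Int.isCoprime_iff_gcd_eq_one.mpr (by decide)) KubertTateM115Descent.not_seven_dvd_Δ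
    KubertTateM115Descent.shaCorank_seven_eq_zero
  rwa [KubertTateM115Descent.mordellWeilRank_eq] at h

/-- **`r_an(E_{−8}) ≤ 1 = rank E_{−8}(ℚ)` from X2 alone.** [cite: GreenbergLNM1716, §1 (pp. 54–57)] -/
theorem analyticRank_M81_le_one_of_X2 (hX2 : AnalyticRankLeSelmerCorank) :
    haveI := KubertTateM81Descent.isElliptic
    (kubertTateSeven (((-8 : ℤ) : ℚ)) (((1 : ℤ) : ℚ))).analyticRank ≤ 1 := by
  haveI := KubertTateM81Descent.isElliptic
  have h := analyticRank_le_mordellWeilRank_of_X2 hX2 (-8) 1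
    (Int.isCoprime_iff_gcd_eq_one.mpr (by decide)) KubertTateM81Descent.not_seven_dvd_Δ
    KubertTateM81Descent.shaCorank_seven_eq_zero
  rwa [KubertTateM81Descent.mordellWeilRank_eq] at h

/-- **`r_an(E_{17}) ≤ 1 = rank E_{17}(ℚ)` from X2 alone.** [cite: GreenbergLNM1716, §1 (pp. 54–57)] -/
theorem analyticRank_171_le_one_of_X2 (hX2 : AnalyticRankLeSelmerCorank) :
    haveI := KubertTate171Descent.isElliptic
    (kubertTateSeven (((17 : ℤ) : ℚ)) (((1 : ℤ) : ℚ))).analyticRank ≤ 1 := by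
  haveI := KubertTate171Descent.isElliptic
  have h := analyticRank_le_mordellWeilRank_of_X2 hX2 17 1
    (Int.isCoprime_iff_gcd_eq_one.mpr (by decide)) KubertTate171Descent.not_seven_dvd_Δ
    KubertTate171Descent.shaCorank_seven_eq_zero
  rwa [KubertTate171Descent.mordellWeilRank_eq] at h

/-! ## §5 EVERY elliptic curve over `ℚ` with a rational point of order `7` -/

/-- **Every elliptic curve over `ℚ` with a rational point of order `7` has a global minimal model of Kubert–Tate
shape `E_{m,n}`** (`m, n` coprime): the model of `KubertTateSevenRational` is globally minimal by
`isGloballyMinimal_kubertTateSeven_of_isCoprime`. [cite: SilvermanAEC2009, VIII.8 and VII.1 Remark 1.1]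
[cite: Kubert1976, Table 3 (N = 7)] -/
theorem exists_globallyMinimal_kubertTateSeven_model (W : WeierstrassCurve ℚ) (P : W.toAffine.Point)
    (hP : addOrderOf P = 7) :
    ∃ (m n : ℤ) (C : VariableChange ℚ), C • W = kubertTateSeven (m : ℚ) (n : ℚ) ∧ IsCoprime m n ∧
      m ≠ 0 ∧ n ≠ 0 ∧ m ≠ n ∧ (kubertTateSeven (m : ℚ) (n : ℚ)).IsGloballyMinimal := by
  obtain ⟨m, n, C, hC, hcop, hm, hn, hmn⟩ :=
    exists_variableChange_eq_kubertTateSeven_of_addOrderOf_eq_seven W P hP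
  exact ⟨m, n, C, hC, hcop, hm, hn, hmn, isGloballyMinimal_kubertTateSeven_of_isCoprime m n hcop⟩

/-- Good reduction at `7` of the coprime Kubert–Tate model means `7 ∤ Δ(E_{m,n})` (the model is globally
minimal, so `Δ_min = Δ(E_{m,n})`). [cite: SilvermanAEC2009, VII.5 Prop. 5.1(a)] -/
theorem not_seven_dvd_Δ_of_hasGoodReductionAtPrime (m n : ℤ) (hcop : IsCoprime m n)
    (hgood : (kubertTateSeven (m : ℚ) (n : ℚ)).HasGoodReductionAtPrime 7) :
    ¬ (7 : ℤ) ∣ (kubertTateSeven m n).Δ := by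
  haveI := isGloballyMinimal_kubertTateSeven_of_isCoprime m n hcop
  have h := not_dvd_minimalDiscriminantInt_of_hasGoodReductionAtPrime (W := kubertTateSeven (m : ℚ) (n : ℚ))
    7 hgood
  rw [IntModel.minimalDiscriminantInt_eq (integralModelInt_kubertTateSeven m n), mk_eq_kubertTateSeven_int] at h
  exact_mod_cast h

/-- **Every elliptic curve over `ℚ` with a rational point of order `7` and good reduction at `7` is ANOMALOUS at
`7`: `a₇(E) = 1`** (global minimal model `E`; `a_p` is an isomorphism invariant at good primes, tree
`frobeniusTrace_eq_of_isIsogenous`; the Kubert–Tate model has `#Ẽ(𝔽₇) = 7`).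
[cite: SilvermanAEC2009, VII.3 Prop. 3.1(b) and VII.5 Prop. 5.1(a)] -/
theorem frobeniusTrace_seven_eq_one_of_addOrderOf_eq_seven (W : WeierstrassCurve ℚ) [W.IsElliptic]
    [W.IsGloballyMinimal] (P : W.toAffine.Point) (hP : addOrderOf P = 7)
    (hgood : W.HasGoodReductionAtPrime 7) : W.frobeniusTrace 7 = 1 := by
  obtain ⟨m, n, C, hC, hcop, -, -, -⟩ := exists_variableChange_eq_kubertTateSeven_of_addOrderOf_eq_seven W P hP
  haveI hE : (kubertTateSeven (m : ℚ) (n : ℚ)).IsElliptic := by rw [← hC]; infer_instance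
  have hgood' : (kubertTateSeven (m : ℚ) (n : ℚ)).HasGoodReductionAtPrime 7 := by
    rw [← hC]; exact (hasGoodReductionAtPrime_iff_of_variableChange W C 7).mpr hgood
  have h7 : ¬ (7 : ℤ) ∣ (kubertTateSeven m n).Δ := not_seven_dvd_Δ_of_hasGoodReductionAtPrime m n hcop hgood'
  haveI := isGloballyMinimal_kubertTateSeven m n hcop h7
  rw [frobeniusTrace_eq_of_isIsogenous (isIsogenous_of_smul_eq hC) 7 hgood hgood']
  exact frobeniusTrace_seven m n hcop h7

/-- **`7` is good ORDINARY for every elliptic curve over `ℚ` with a rational point of order `7` and good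
reduction at `7`.** [cite: SilvermanAEC2009, VII.5 Prop. 5.1(a)] -/
theorem isOrdinaryAt_seven_of_addOrderOf_eq_seven (W : WeierstrassCurve ℚ) [W.IsElliptic]
    [W.IsGloballyMinimal] (P : W.toAffine.Point) (hP : addOrderOf P = 7)
    (hgood : W.HasGoodReductionAtPrime 7) : IsOrdinaryAt W 7 := by
  refine ⟨hgood, ?_⟩
  rw [frobeniusTrace_seven_eq_one_of_addOrderOf_eq_seven W P hP hgood]
  decide

/-- **X2 applies at `p = 7` to EVERY elliptic curve over `ℚ` with a rational point of order `7` and good reduction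
at `7`**: granting `AnalyticRankLeSelmerCorank`, `ord_{s=1} L(E, s) ≤ s₇(E)` (global minimal model `E`).
CONDITIONAL on `hX2` only. [cite: GreenbergLNM1716, §1 (pp. 54–57)] -/
theorem analyticRank_le_selmerCorank_seven_of_X2_of_addOrderOf_eq_seven (hX2 : AnalyticRankLeSelmerCorank)
    (W : WeierstrassCurve ℚ) [W.IsElliptic] [W.IsGloballyMinimal] (P : W.toAffine.Point)
    (hP : addOrderOf P = 7) (hgood : W.HasGoodReductionAtPrime 7) :
    W.analyticRank ≤ W.selmerCorank 7 :=
  hX2 W 7 (by norm_num) hgood (by rw [frobeniusTrace_seven_eq_one_of_addOrderOf_eq_seven W P hP hgood]; decide)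

/-- **… and without the global-minimality instance**: for ANY elliptic `W/ℚ` with a rational point of order `7`
whose coprime Kubert–Tate model `E_{m,n} = C • W` is tame (`7 ∤ Δ(E_{m,n})`), X2 gives `r_an(W) ≤ s₇(W)`, and
`r_an(W) ≤ rank W(ℚ)` when the door is open (`t₇(W) = 0`) — `r_an`, `s₇`, `t₇`, rank are carried along `C`.
CONDITIONAL on `hX2` only. [cite: GreenbergLNM1716, §1 (pp. 54–57)] [cite: SilvermanAEC2009, App. C §16] -/
theorem analyticRank_le_mordellWeilRank_of_X2_of_smul_eq (hX2 : AnalyticRankLeSelmerCorank)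
    (W : WeierstrassCurve ℚ) [W.IsElliptic] (m n : ℤ) (C : VariableChange ℚ)
    (hC : C • W = kubertTateSeven (m : ℚ) (n : ℚ)) (hcop : IsCoprime m n)
    (h7 : ¬ (7 : ℤ) ∣ (kubertTateSeven m n).Δ) (ht : W.shaCorank 7 = 0) :
    W.analyticRank ≤ W.mordellWeilRank := by
  haveI hE : (kubertTateSeven (m : ℚ) (n : ℚ)).IsElliptic := by rw [← hC]; infer_instance
  have ht' : (kubertTateSeven (m : ℚ) (n : ℚ)).shaCorank 7 = 0 :=
    (shaCorank_eq_zero_iff_of_smul_eq W _ C hC 7).mp ht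
  have h := analyticRank_le_mordellWeilRank_of_X2 hX2 m n hcop h7 ht'
  rwa [← mordellWeilRank_eq_of_smul_eq W _ C hC, ← hC, analyticRank_smul] at h

end Summit.BirchSwinnertonDyer.BirchSwinnertonDyer.Theorems.ShaPrimaryTransferRowAtSevenClassWide

end
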